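import Summits.KontsevichZagierPeriods.KontsevichZagierPeriods.Theorems.HermiteRigidityPolylogRigidity
import Literature.NumberTheory.DiophantineApproximation.PolylogLinearIndependenceRational

/-!
# `ReductionRigidity` (stmt-KontsevichZagierPeriods-3407), line `Sketch`, growth programme
# DilogRigidity, wave 4: EVERY WEIGHT AT RATIONAL LEVELS `ν = N/M`

Route `KontsevichZagierPeriods/HermiteRigidity`, crux `ReductionRigidity` (lead c5). The every-weight
island theorem `padeBoxKernelGen w ν` (Theorems/…PadeBoxIslandsAllWeights.lean) at a RATIONAL level
`ν = N/M > 1` is conditional on the `ℚ`-rigidity of `Lᵢ = ∫_□ⁱ dx/(ν − ∏ x)` (`i ≤ w`;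
`L₀ = 1/(ν−1) = M/(N−M)`, `Lᵢ = Liᵢ(M/N)`). The Literature theorem
`one_polylog_linearIndependent_rat` (`log N ≥ (w+1)³ + 2w log M`) discharges it:

* `stub_polylogRigidityRat` — for `w ≥ 1`, `M ≥ 1`, `N ≥ 3^{(w+1)³}·M^{2w}` the values `L₀, …, L_w`
  at level `N/M` are linearly independent over `ℚ`;
* `stub_padeBoxKernelGenRatUnconditional` — hence **`padeBoxKernelGen w (N/M)` holds with NO
  hypothesis for every weight `w ≥ 1` and every rational level `N/M` with `N ≥ 3^{(w+1)³} M^{2w}`**.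
  Together with `stub_padeBoxKernelGenUnconditional` (integer levels) this makes the Padé box island
  programme of the crux unconditional at all deep rational levels `ν > 1` in every weight; only the
  negative levels `ν < 0` of `padeBoxKernelGen` keep their inlined hypothesis.

References: M. Kontsevich, D. Zagier, *Periods* (2001), §1.2 [cite: KontsevichZagier2001, §1.2];
S. David, N. Hirata-Kohno, M. Kawashima, Moscow J. Comb. Number Th. 9 (2020), Thm 2.1
[cite: DavidHirataKohnoKawashima2020, Thm 2.1].
-/

noncomputable section

open MeasureTheory Set

namespace Summit.KontsevichZagierPeriods.HermiteRigidity.ReductionRigidity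

open Literature.NumberTheory.Transcendental
open Literature.NumberTheory.Transcendental.KZ
open Literature.NumberTheory.DiophantineApproximation

/-- `N ≥ 3^{(w+1)³} M^{2w}` gives `log N ≥ (w+1)³ + 2w log M` (`log 3 ≥ 1`). [folklore] -/
theorem log_ge_of_three_pow_mul_le {w M N : ℕ} (hM : 1 ≤ M) (hN : 3 ^ ((w + 1) ^ 3) * M ^ (2 * w) ≤ N) :
    ((w : ℝ) + 1) ^ 3 + 2 * w * Real.log M ≤ Real.log N := by
  have h3 : (1 : ℝ) ≤ Real.log 3 := by
    rw [Real.le_log_iff_exp_le (by norm_num)]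
    have := Real.exp_one_lt_d9
    linarith
  have hMr : (1 : ℝ) ≤ M := by exact_mod_cast hM
  have hpos : (0 : ℝ) < (3 : ℝ) ^ ((w + 1) ^ 3) * (M : ℝ) ^ (2 * w) := by positivity
  have hN' : (3 : ℝ) ^ ((w + 1) ^ 3) * (M : ℝ) ^ (2 * w) ≤ N := by exact_mod_cast hN
  have h1 := Real.log_le_log hpos hN'
  rw [Real.log_mul (by positivity) (by positivity), Real.log_pow, Real.log_pow] at h1
  push_cast at h1
  have h2 : ((w : ℝ) + 1) ^ 3 ≤ ((w : ℝ) + 1) ^ 3 * Real.log 3 := by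
    calc ((w : ℝ) + 1) ^ 3 = ((w : ℝ) + 1) ^ 3 * 1 := (mul_one _).symm
      _ ≤ ((w : ℝ) + 1) ^ 3 * Real.log 3 := mul_le_mul_of_nonneg_left h3 (by positivity)
  linarith

/-- `N ≥ 3^{(w+1)³} M^{2w}` with `w, M ≥ 1` gives `N ≥ 2M`. [folklore] -/
theorem two_mul_le_of_three_pow_mul_le {w M N : ℕ} (hw : 1 ≤ w) (hM : 1 ≤ M)
    (hN : 3 ^ ((w + 1) ^ 3) * M ^ (2 * w) ≤ N) : 2 * M ≤ N := by
  have h1 : 2 ≤ 3 ^ ((w + 1) ^ 3) := by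
    have : 1 ≤ (w + 1) ^ 3 := Nat.one_le_pow _ _ (by omega)
    calc 2 ≤ 3 ^ 1 := by norm_num
      _ ≤ 3 ^ ((w + 1) ^ 3) := Nat.pow_le_pow_right (by norm_num) this
  have h2 : M ≤ M ^ (2 * w) := by
    calc M = M ^ 1 := (pow_one M).symm
      _ ≤ M ^ (2 * w) := Nat.pow_le_pow_right hM (by omega)
  calc 2 * M ≤ 3 ^ ((w + 1) ^ 3) * M ^ (2 * w) := Nat.mul_le_mul h1 h2
    _ ≤ N := hN

/-- The constant normal-form value at a rational point as a series:
`L₀(M/N) = ∑_{k≥1} (M/N)^k = M/(N−M)` (`1 ≤ M`, `2M ≤ N`). [folklore] -/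
theorem polylogSeries_zero_eq_rat {M N : ℕ} (hM : 1 ≤ M) (hMN : 2 * M ≤ N) :
    DilogPade.polylogSeries 0 ((M : ℝ) / N) = (M : ℝ) / ((N : ℝ) - M) := by
  have hMr : (1 : ℝ) ≤ M := by exact_mod_cast hM
  have hMN' : 2 * (M : ℝ) ≤ N := by exact_mod_cast hMN
  have hNpos : (0 : ℝ) < N := by linarith
  have hx0 : (0 : ℝ) ≤ (M : ℝ) / N := by positivity
  have hx1 : (M : ℝ) / N < 1 := by rw [div_lt_one hNpos]; linarith
  rw [DilogPade.polylogSeries]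
  simp only [pow_zero, div_one, pow_succ]
  rw [tsum_mul_right, tsum_geometric_of_lt_one hx0 hx1]
  have : (N : ℝ) - M ≠ 0 := by linarith
  field_simp

/-- STUB `polylogRigidityRat` (growth programme DilogRigidity wave 4, line `Sketch`, crux
stmt-KontsevichZagierPeriods-3407): at the rational level `N/M` with `w ≥ 1`, `M ≥ 1`,
`N ≥ 3^{(w+1)³} M^{2w}`, the normal-form values `Lᵢ = ∫_□ⁱ dx/(N/M − ∏ x)` (`i ≤ w`) are linearly
independent over `ℚ` (`one_polylog_linearIndependent_rat` after identifying the integrals with the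
series `Liᵢ(M/N)` by `stub_cubeIntegralSeriesLevel`; `L₀ = M/(N−M)` is rational).
[cite: DavidHirataKohnoKawashima2020, Thm 2.1] -/
theorem stub_polylogRigidityRat : ∀ (w M N : ℕ), 1 ≤ w → 1 ≤ M → 3 ^ ((w + 1) ^ 3) * M ^ (2 * w) ≤ N →
    ∀ β : ℕ → ℚ,
      (∑ i ∈ Finset.range (w + 1), (β i : ℝ) * ∫ p in cube i, 1 / ((N : ℝ) / (M : ℝ) - ∏ l, p l)) = 0 →
        ∀ i ∈ Finset.range (w + 1), β i = 0 := by
  intro w M N hw hM hN β hβ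
  have hlog := log_ge_of_three_pow_mul_le hM hN
  have h2M := two_mul_le_of_three_pow_mul_le hw hM hN
  have hMr : (1 : ℝ) ≤ M := by exact_mod_cast hM
  have hMpos : (0 : ℝ) < M := by linarith
  have h2Mr : 2 * (M : ℝ) ≤ N := by exact_mod_cast h2M
  have hν : (2 : ℝ) ≤ (N : ℝ) / M := by rw [le_div_iff₀ hMpos]; linarith
  have hNMq : (M : ℚ) / ((N : ℚ) - M) ≠ 0 := by
    have h1 : (1 : ℚ) ≤ M := by exact_mod_cast hM
    have h2 : 2 * (M : ℚ) ≤ N := by exact_mod_cast h2M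
    exact div_ne_zero (by linarith) (by linarith)
  -- the integrals are the series at `M/N`
  have hL : ∀ i, (∫ p in cube i, 1 / ((N : ℝ) / (M : ℝ) - ∏ l, p l)) =
      DilogPade.polylogSeries i ((M : ℝ) / N) := by
    intro i
    rw [stub_cubeIntegralSeriesLevel i ((N : ℝ) / M) hν, DilogPade.polylogSeries, one_div_div]
  simp only [hL] at hβ
  rw [Finset.sum_range_succ', polylogSeries_zero_eq_rat hM h2M] at hβ
  set a : Fin (w + 1) → ℚ :=
    Fin.cases (β 0 * ((M : ℚ) / ((N : ℚ) - M))) (fun j => β ((j : ℕ) + 1)) with ha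
  have hrel : (a 0 : ℝ) + ∑ j : Fin w, (a j.succ : ℝ) *
      DilogPade.polylogSeries ((j : ℕ) + 1) ((M : ℝ) / N) = 0 := by
    simp only [ha, Fin.cases_zero, Fin.cases_succ]
    rw [← Finset.sum_range (fun i => (β (i + 1) : ℝ) *
      DilogPade.polylogSeries (i + 1) ((M : ℝ) / N))]
    push_cast
    linear_combination hβ
  have h0 := one_polylog_linearIndependent_rat w hw M N hM hlog a hrel
  intro i hi
  have hi' : i < w + 1 := Finset.mem_range.1 hi
  rcases i with _ | i
  · have : a 0 = 0 := by rw [h0]; rfl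
    simp only [ha, Fin.cases_zero] at this
    rcases mul_eq_zero.1 this with h | h
    · exact h
    · exact absurd h hNMq
  · have : a ⟨i + 1, hi'⟩ = 0 := by rw [h0]; rfl
    have e : (⟨i + 1, hi'⟩ : Fin (w + 1)) = Fin.succ ⟨i, by omega⟩ := rfl
    rw [e] at this
    simpa [ha] using this

/-- STUB `padeBoxKernelGenRatUnconditional` (growth programme DilogRigidity wave 4, line `Sketch`, crux
stmt-KontsevichZagierPeriods-3407): **the Padé box islands of every weight are unconditional at every
deep rational level** — for `w ≥ 1`, `M ≥ 1` and `N ≥ 3^{(w+1)³} M^{2w}`, Conjecture 1 of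
Kontsevich–Zagier in kernel form holds on the sector of all box generators
`[□ʲ, ∏ x_l^{a_l}/(N/M − ∏ x_l)^m]` of dimension `j ≤ w` at level `ν = N/M`, with NO hypothesis
(`padeBoxKernelGen w (N/M)` fed with `stub_polylogRigidityRat`). [cite: KontsevichZagier2001, §1.2] -/
theorem stub_padeBoxKernelGenRatUnconditional : ∀ (w M N : ℕ), 1 ≤ w → 1 ≤ M →
    3 ^ ((w + 1) ^ 3) * M ^ (2 * w) ≤ N →
    ∀ c ∈ AddSubgroup.closure
      {c | ∃ (j : ℕ) (r : IntegralRep j) (a : Fin j → ℕ) (m : ℕ), j ≤ w ∧ r.domain = cube j ∧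
          EqOn r.integrand
            (fun p => (∏ l, p l ^ a l) / ((((N : ℚ) / (M : ℚ) : ℚ) : ℝ) - ∏ l, p l) ^ m) (cube j) ∧
          c = KZ.of r},
      KZ.eval c = 0 → c ∈ KZ.relations := by
  intro w M N hw hM hN
  have h2M := two_mul_le_of_three_pow_mul_le hw hM hN
  have hMq : (1 : ℚ) ≤ M := by exact_mod_cast hM
  have hMNq : (M : ℚ) < N := by
    have : 2 * (M : ℚ) ≤ N := by exact_mod_cast h2M
    linarith
  have hν : (1 : ℚ) < (N : ℚ) / M ∨ (N : ℚ) / M < 0 :=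
    Or.inl ((one_lt_div (by linarith)).2 hMNq)
  refine padeBoxKernelGen w ((N : ℚ) / M) hν fun β hβ => ?_
  have hcast : ((((N : ℚ) / M : ℚ)) : ℝ) = (N : ℝ) / (M : ℝ) := by push_cast; ring
  simp only [hcast] at hβ
  exact stub_polylogRigidityRat w M N hw hM hN β hβ

end Summit.KontsevichZagierPeriods.HermiteRigidity.ReductionRigidity

end
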